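import Summits.BirchSwinnertonDyer.Rank1Residual.Additive.SignedTwistDualTransport
import Summits.BirchSwinnertonDyer.Rank1Residual.Additive.SignedTwistLocalGalois
import Summits.BirchSwinnertonDyer.Rank1Residual.Additive.CyclotomicTowerSignedSelmerDual
import Summits.BirchSwinnertonDyer.Rank1Residual.Additive.QuadraticBranchOddStrictSelmerReadings
import Summits.BirchSwinnertonDyer.Rank1Residual.Additive.ChiEigenPrimeToPDescentGenerator
import Summits.BirchSwinnertonDyer.Rank1Residual.Additive.QuadraticTwistTypeG
import Summits.BirchSwinnertonDyer.Rank1Residual.Additive.CyclotomicQuadraticSubfield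
import HarnessLib

/-!
# (T-O7ss-P5, file P5-5b) The three readings DISCHARGED from VERBATIM fact shapes by the
# signed-`η` twist dictionary: (R1) Kobayashi Thm. 2.2 + 4.1 at `η`, (R2) Kitajima–Otsuki
# Thm. 1.3 (sign `−`, `η`-part), (R3) Kobayashi Thm. 7.4 at `η` on top of (C1_η)

Cell n1011 (b2b / bsd-rank1-residual), row T-O7ss-P13 follow-up (P5), skeleton
`cells/n1011/skel/T-O7ss-P5.md` §2 (D5′); cc-typer-6 GEN 12 FIRST SAY (Q1)–(Q4)
(`class-closure/typer-6/P5-FIRST-SAY-typer6.md` 7449620a6c2769d1): (Q1) the three VERBATIM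
SHAPES are taken here as HYPOTHESES (texts `H22` / `H41` / `HKO` of cc-typer-6's scratch
`class-closure/typer-6/lean/SignedSelmerEtaFactsScratch.lean` ae3d686d65dd3b0e, INTRINSIC
`η`-pin `(∀ σ ∈ galRange K₀, η σ = 1) [→ η ≠ 1]`, copied verbatim; the `h74` text is the same
frame with `QuadraticBranchPlusMainConjectureAt V p` in place of the image hypothesis, lead R5-69
(m) / R5-71) — 0 `def`s here; the Literature facts, when minted after promotion events
6916077 / 6916103, instantiate them with NO glue; (Q3) names as ruled.

HONEST FRAMING. The programme this file serves is a CONDITIONAL ASSEMBLY of the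
Birch–Swinnerton-Dyer formula for ALL analytic-rank `≤ 1` elliptic curves over `ℚ` — "full BSD
formula for every rank `≤ 1` curve in class `C`" assembled STRICTLY from published theorems — so
that the rank-`≤ 1` remainder becomes exactly the CONSTRUCTION-SHAPED classes, which are TYPED
(missing-input `Prop`s), NOT attempted. This is not "finishing BSD". Research route on
O7-ss ∩ (G)∧ss ∩ e = 2 (OPEN) / X4 CONSTRUCTION-SHAPED; nothing here is booked; no label moves.
TOOL THEOREMS ONLY: the typed inputs (R1) `OddBranchStrictMinusDivisibilityAt`, (R2)
`OddBranchStrictMinusNoFiniteSubmoduleAt`, (R3) `OddBranchStrictMinusDivisibilityOfPlusMCAt`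
(p17 GEN 3, `QuadraticBranchOddStrictSelmerReadings.lean`) become CONSEQUENCES of the verbatim
shapes of the printed theorems on cc-typer-6's object `EtaSignedSelmerDualData` — the shapes stay
HYPOTHESES (no Literature fact is minted here; reading flags `Kob03-Thm41-odd-eta-twist-reading`,
`KO18-minus-eta-twist-reading` / `KO18-eta-summand`, `Kob03-Thm74-eta-by-eta` +
`Kob03-MC-eta-quadratic-subtower` travel with the texts); no `sorry`; axioms standard.

## The dictionary instance (`E = ℚ_[p]`, `K₀ = ℚ(μ_p) = CyclotomicField p ℚ`, `θ` = Gauss sum)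
`θ² = p*` (`exists_sq_eq_pStar`, `θ ∉ ℚ` by `forall_sq_ne_pStar`); `η` by [SIGN]
(`exists_eta_iff_smul_rootInClosure`; `η = 1` on `Gal(ℚ̄/K₀)`, `η ≠ 1`); (D0) by
`localTowerHyp_padic`; `κ(Gal(ℚ̄/K₀)) = ℤ_p` (`kappa_surjOn_galRange_cyclotomic`);
`p ∤ [K₀ : ℚ] = p − 1` (`coprime_index_galRange_cyclotomic`); the consumer's topological
generator `γ` is moved to `γ' ∈ Gal(ℚ̄/K₀)` with `κ γ' = κ γ` (`γ⁻¹γ' ∈ ker κ`; the cyclotomic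
variable survives, `isCyclotomicVariable_of_inv_mul_mem_ker`), and the consumer's datum `D` of
`X^{−,str}(W/ℚ_∞)` is read as `D.toEtaSigned … : EtaSignedSelmerDualData V κ K₀ ℚ_[p] η γ' (-1)`
with the SAME module (P5-5a).

References: S. Kobayashi, Invent. Math. 152 (2003) Thm. 2.2 (p. 5), §3 p. 5, §4 p. 8 + Thm. 4.1,
Thm. 7.4 (p. 13) [Kobayashi2003]; T. Kitajima, R. Otsuki, Tokyo J. Math. 41 (2018) Main Thm. 1.3
with Def. 2.1 [KitajimaOtsuki2018].
-/

noncomputable section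

open scoped Classical

open CongruenceSubgroup WeierstrassCurve Field

namespace Summit.BirchSwinnertonDyer.Rank1Residual.Additive.SignedTwist

open Literature.NumberTheory.EllipticCurves Literature.NumberTheory.EllipticCurves.ModularForms
  Literature.NumberTheory.GaloisRepresentations Literature.NumberTheory.EllipticCurves.Kobayashi2003
  Summit.BirchSwinnertonDyer.Rank1Residual.AdditivePotMult ZpExtension

/-! ## §1 The cyclotomic variable survives the change `γ ↦ γ'` -/

/-- **`γ ↔ 1 + X` passes to `γ'`**: for the cyclotomic `κ` (`ker κ = χ_p⁻¹(μ(ℤ_p))`) and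
`γ⁻¹γ' ∈ ker κ`, `χ_p(γ') = χ_p(γ)·ζ₀` with `ζ₀` of finite order, so `IsCyclotomicVariable p γ →
IsCyclotomicVariable p γ'`. [cite: Kobayashi2003, §3 p. 5 (γ identified with 1 + X)] -/
theorem isCyclotomicVariable_of_inv_mul_mem_ker {p : ℕ} [Fact p.Prime] {κ : ZpExtension ℚ p}
    (hκ : κ.IsCyclotomic) {γ γ' : absoluteGaloisGroup ℚ} (h : γ⁻¹ * γ' ∈ κ.kerSubgroup)
    (hγ : IsCyclotomicVariable p γ) : IsCyclotomicVariable p γ' := by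
  obtain ⟨ζ, hζ, hγζ⟩ := hγ
  have ht : GaloisRep.cyclotomicCharacter ℚ p (γ⁻¹ * γ') ∈ CommGroup.torsion ℤ_[p]ˣ := by
    rw [ZpExtension.IsCyclotomic] at hκ
    rw [hκ] at h
    exact h
  have hχ : GaloisRep.cyclotomicCharacter ℚ p γ' =
      GaloisRep.cyclotomicCharacter ℚ p γ * GaloisRep.cyclotomicCharacter ℚ p (γ⁻¹ * γ') := by
    rw [← map_mul, mul_inv_cancel_left]
  refine ⟨(GaloisRep.cyclotomicCharacter ℚ p (γ⁻¹ * γ'))⁻¹ * ζ, ?_, ?_⟩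
  · exact (Commute.all _ _).isOfFinOrder_mul ((CommGroup.mem_torsion _).mp (inv_mem ht)) hζ
  · rw [hχ, mul_assoc, mul_inv_cancel_left]
    exact hγζ

/-! ## §2 The dictionary instance `K₀ = ℚ(μ_p)`, `θ² = p*` -/

section Instance

variable (p : ℕ) [Fact p.Prime]

/-- **The data of the dictionary at `K₀ = ℚ(μ_p)`** (`p` odd): a square root `θ` of `p*` in
`ℚ(μ_p)` (Gauss), not rational, its sign character `η` ([SIGN]), trivial on `Gal(ℚ̄/ℚ(μ_p))` and
non-trivial. [cite: Kobayashi2003, §4 p. 8 (η = ω^{(p−1)/2})] -/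
theorem exists_theta_eta_cyclotomicField (hp2 : p ≠ 2) :
    ∃ (θ : CyclotomicField p ℚ) (η : absoluteGaloisGroup ℚ →* ℤˣ),
      θ ∉ Set.range (algebraMap ℚ (CyclotomicField p ℚ)) ∧
      θ ^ 2 = algebraMap ℚ (CyclotomicField p ℚ) ((-1) ^ (p / 2) * p) ∧
      (∀ σ, η σ = 1 ↔ σ • rootInClosure (CyclotomicField p ℚ) θ =
        rootInClosure (CyclotomicField p ℚ) θ) ∧
      (∀ σ ∈ galRange (K := ℚ) (CyclotomicField p ℚ), η σ = 1) ∧ η ≠ 1 := by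
  haveI : NeZero p := ⟨(Fact.out : p.Prime).ne_zero⟩
  haveI : IsCyclotomicExtension {p} ℚ (CyclotomicField p ℚ) :=
    CyclotomicField.isCyclotomicExtension p ℚ
  obtain ⟨θ, hθ2⟩ := exists_sq_eq_pStar p (CyclotomicField p ℚ) hp2
  have hc : θ ^ 2 = algebraMap ℚ (CyclotomicField p ℚ) ((-1) ^ (p / 2) * p) := by
    rw [hθ2, map_mul, map_pow, map_neg, map_one, map_natCast]
  have hθ : θ ∉ Set.range (algebraMap ℚ (CyclotomicField p ℚ)) := by
    rintro ⟨q, hq⟩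
    apply forall_sq_ne_pStar p q
    apply (algebraMap ℚ (CyclotomicField p ℚ)).injective
    rw [map_pow, hq, hc]
  obtain ⟨η, hη⟩ := exists_eta_iff_smul_rootInClosure (CyclotomicField p ℚ) hθ hc
  refine ⟨θ, η, hθ, hc, hη, fun σ hσ ↦ (hη σ).mpr (apply_rootInClosure_of_mem _ hσ), ?_⟩
  obtain ⟨σ, hσ⟩ := exists_smul_rootInClosure_ne (CyclotomicField p ℚ) hθ
  intro h1
  exact hσ ((hη σ).mp (by rw [h1, MonoidHom.one_apply]))

end Instance

/-! ## §3 The three readings from the verbatim shapes -/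

section Readings

variable (W : WeierstrassCurve ℚ) [W.IsElliptic] [W.IsGloballyMinimal] (p : ℕ) [Fact p.Prime]

/-- **(R1) from the VERBATIM shapes of Kobayashi Thm. 2.2 and Thm. 4.1 (third display, `η ≠ 1`)
on cc-typer-6's object, by the dictionary.** Hypotheses `h22` / `h41` are EXACTLY the texts
`H22 p` / `H41 p` of cc-typer-6's scratch (intrinsic `η`-pin; reading flag
`Kob03-Thm41-odd-eta-twist-reading` retired in favour of the verbatim shape + this theorem).
Proof: at `K₀ = ℚ(μ_p)`, `θ² = p*`, move the consumer's generator `γ` to `γ' ∈ Gal(ℚ̄/K₀)` with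
`κ γ' = κ γ`, read `D` as `D.toEtaSigned` (same module, same characteristic ideal), apply the
shapes, and turn `L' ∈ (g)` into `g ∣ L'`. NOTHING about Kobayashi's theorems is asserted here.
[cite: Kobayashi2003, Thm. 2.2 (p. 5), §4 p. 8 and Thm. 4.1 (p. 8), §3 p. 5] -/
theorem oddBranchStrictMinusDivisibilityAt_of_kobayashi41OddEta
    (h22 : ∀ (K₀ : Type) [Field K₀] [NumberField K₀] [IsCyclotomicExtension {p} ℚ K₀]
        [(galRange (K := ℚ) K₀).Normal] (η : absoluteGaloisGroup ℚ →* ℤˣ),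
        (∀ σ ∈ galRange (K := ℚ) K₀, η σ = 1) →
      ∀ (V : WeierstrassCurve ℚ) [V.IsElliptic] [V.IsGloballyMinimal],
        p ≠ 2 → V.HasGoodReductionAtPrime p → V.frobeniusTrace p = 0 →
      ∀ (κ : ZpExtension ℚ p) (γ : absoluteGaloisGroup ℚ),
        κ.IsCyclotomic → κ.IsTopGenerator γ → γ ∈ galRange (K := ℚ) K₀ →
      ∀ (ε : ℤˣ) (D : EtaSignedSelmerDualData V κ K₀ ℚ_[p] η γ ε),
        Module.Finite (IwasawaAlgebra p) D.X ∧ Module.IsTorsion (IwasawaAlgebra p) D.X)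
    (h41 : ∀ (K₀ : Type) [Field K₀] [NumberField K₀] [IsCyclotomicExtension {p} ℚ K₀]
        [(galRange (K := ℚ) K₀).Normal] (η : absoluteGaloisGroup ℚ →* ℤˣ),
        (∀ σ ∈ galRange (K := ℚ) K₀, η σ = 1) → η ≠ 1 →
      ∀ (V : WeierstrassCurve ℚ) [V.IsElliptic] [V.IsGloballyMinimal] {N : ℕ} [NeZero N]
        {f : CuspForm (Gamma0 N) 2},
        p ≠ 2 → V.HasGoodReductionAtPrime p → V.frobeniusTrace p = 0 → IsNewformOf V f →
      ∀ (ϖ : ℚ), (if Even (p / 2) then (ϖ : ℝ) * V.realPeriodRat = plusPeriod f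
          else (ϖ : ℝ) * V.imaginaryPeriodRat = minusPeriod f) →
      ∀ (Lη : IwasawaAlgebra p), IsQuadraticBranchMinusLFunction f p ϖ Lη →
      ∀ (κ : ZpExtension ℚ p) (γ : absoluteGaloisGroup ℚ),
        κ.IsCyclotomic → κ.IsTopGenerator γ → γ ∈ galRange (K := ℚ) K₀ →
        IsCyclotomicVariable p γ →
      ∀ (D : EtaSignedSelmerDualData V κ K₀ ℚ_[p] η γ (-1)),
        Module.Finite (IwasawaAlgebra p) D.X → Module.IsTorsion (IwasawaAlgebra p) D.X →
        (∃ n : ℕ, ∀ L' : IwasawaAlgebra p, Lη = PowerSeries.X * L' →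
            (p : IwasawaAlgebra p) ^ n * L' ∈ D.charIdeal) ∧
        ((∀ m : ℕ, V.HasSurjectiveModNGaloisRep (p ^ m : ℕ)) →
            ∀ L' : IwasawaAlgebra p, Lη = PowerSeries.X * L' → L' ∈ D.charIdeal)) :
    OddBranchStrictMinusDivisibilityAt W p := by
  intro V _ _ C N _ f hp2 hCV hgood hap hsurj hf ϖ hϖ Lη hL κ γ hκ hγ hγc D
  haveI : NeZero p := ⟨(Fact.out : p.Prime).ne_zero⟩
  haveI : IsCyclotomicExtension {p} ℚ (CyclotomicField p ℚ) :=
    CyclotomicField.isCyclotomicExtension p ℚ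
  haveI : (galRange (K := ℚ) (CyclotomicField p ℚ)).Normal := normal_galRange_cyclotomic p _
  obtain ⟨θ, η, hθ, hc, hη, hηK, hη1⟩ := exists_theta_eta_cyclotomicField p hp2
  have hD := localTowerHyp_padic p κ (CyclotomicField p ℚ) hκ
  have hκ₀ := kappa_surjOn_galRange_cyclotomic κ (CyclotomicField p ℚ)
  have hcop := coprime_index_galRange_cyclotomic p (CyclotomicField p ℚ)
  obtain ⟨γ', hγ'K, hγ'κ⟩ := hκ₀ (κ γ)
  have hγγ' : γ⁻¹ * γ' ∈ κ.kerSubgroup := by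
    rw [mem_kerSubgroup, map_mul, map_inv, hγ'κ, inv_mul_cancel]
  have hγ' : κ.IsTopGenerator γ' := by rw [ZpExtension.IsTopGenerator, hγ'κ]; exact hγ
  have hγ'c : IsCyclotomicVariable p γ' := isCyclotomicVariable_of_inv_mul_mem_ker hκ hγγ' hγc
  obtain ⟨hfin, htor⟩ := h22 (CyclotomicField p ℚ) η hηK V hp2 hgood hap κ γ' hκ hγ' hγ'K (-1)
    (D.toEtaSigned W (CyclotomicField p ℚ) hθ hc p κ hCV η hη ℚ_[p] hD hκ₀ hcop hγ'K hγγ')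
  refine ⟨hfin, htor, fun g L' hg hL' ↦ ?_⟩
  have hmem := (h41 (CyclotomicField p ℚ) η hηK hη1 V hp2 hgood hap hf ϖ hϖ Lη hL κ γ' hκ hγ'
    hγ'K hγ'c (D.toEtaSigned W (CyclotomicField p ℚ) hθ hc p κ hCV η hη ℚ_[p] hD hκ₀ hcop hγ'K hγγ')
    hfin htor).2 hsurj L' hL'
  rw [StrictSignedSelmerDualData.toEtaSigned_charIdeal, hg] at hmem
  exact Ideal.mem_span_singleton.mp hmem

/-- **(R2) from the VERBATIM shape of Kitajima–Otsuki Main Thm. 1.3 (sign `−`, `η`-part) on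
cc-typer-6's object, by the dictionary.** Hypothesis `hKO` is EXACTLY the text `HKO p` of
cc-typer-6's scratch (intrinsic `η`-pin; docstring flag `KO18-eta-summand`: the print is for
`X⁻(F_∞)` whole, an `η`-part is a direct summand). Same proof as (R1), the finite submodule `M`
living in the SAME module. NOTHING about the printed theorem is asserted here.
[cite: KitajimaOtsuki2018, Main Thm. 1.3 (= Thm. 4.8) with Def. 2.1] [cite: Kobayashi2003, §4 p. 8] -/
theorem oddBranchStrictMinusNoFiniteSubmoduleAt_of_kitajimaOtsuki13MinusEta
    (hKO : ∀ (K₀ : Type) [Field K₀] [NumberField K₀] [IsCyclotomicExtension {p} ℚ K₀]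
        [(galRange (K := ℚ) K₀).Normal] (η : absoluteGaloisGroup ℚ →* ℤˣ),
        (∀ σ ∈ galRange (K := ℚ) K₀, η σ = 1) →
      ∀ (V : WeierstrassCurve ℚ) [V.IsElliptic] [V.IsGloballyMinimal],
        p ≠ 2 → V.HasGoodReductionAtPrime p → V.frobeniusTrace p = 0 →
      ∀ (κ : ZpExtension ℚ p) (γ : absoluteGaloisGroup ℚ),
        κ.IsCyclotomic → κ.IsTopGenerator γ → γ ∈ galRange (K := ℚ) K₀ →
      ∀ (D : EtaSignedSelmerDualData V κ K₀ ℚ_[p] η γ (-1)),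
        Module.Finite (IwasawaAlgebra p) D.X → Module.IsTorsion (IwasawaAlgebra p) D.X →
        ∀ M : Submodule (IwasawaAlgebra p) D.X, Finite M → M = ⊥) :
    OddBranchStrictMinusNoFiniteSubmoduleAt W p := by
  intro V _ _ C hp2 hCV hgood hap κ γ hκ hγ D hfin htor M hM
  haveI : NeZero p := ⟨(Fact.out : p.Prime).ne_zero⟩
  haveI : IsCyclotomicExtension {p} ℚ (CyclotomicField p ℚ) :=
    CyclotomicField.isCyclotomicExtension p ℚ
  haveI : (galRange (K := ℚ) (CyclotomicField p ℚ)).Normal := normal_galRange_cyclotomic p _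
  obtain ⟨θ, η, hθ, hc, hη, hηK, -⟩ := exists_theta_eta_cyclotomicField p hp2
  have hD := localTowerHyp_padic p κ (CyclotomicField p ℚ) hκ
  have hκ₀ := kappa_surjOn_galRange_cyclotomic κ (CyclotomicField p ℚ)
  have hcop := coprime_index_galRange_cyclotomic p (CyclotomicField p ℚ)
  obtain ⟨γ', hγ'K, hγ'κ⟩ := hκ₀ (κ γ)
  have hγγ' : γ⁻¹ * γ' ∈ κ.kerSubgroup := by
    rw [mem_kerSubgroup, map_mul, map_inv, hγ'κ, inv_mul_cancel]
  have hγ' : κ.IsTopGenerator γ' := by rw [ZpExtension.IsTopGenerator, hγ'κ]; exact hγ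
  exact hKO (CyclotomicField p ℚ) η hηK V hp2 hgood hap κ γ' hκ hγ' hγ'K
    (D.toEtaSigned W (CyclotomicField p ℚ) hθ hc p κ hCV η hη ℚ_[p] hD hκ₀ hcop hγ'K hγγ')
    hfin htor M hM

/-- **(R3) from the shape of Kobayashi Thm. 7.4 at `η` (even MC at `η` ⟹ odd MC at `η`) read with
the TYPED (C1_η) `QuadraticBranchPlusMainConjectureAt V p` as hypothesis, on cc-typer-6's object,
by the dictionary.** Hypothesis `h74` is the (R1) frame with the image hypothesis replaced by
(C1_η) (docstring flags `Kob03-Thm74-eta-by-eta`, `Kob03-MC-eta-quadratic-subtower`: the plus-side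
dictionary is NOT part of (P5); (C1_η) is a CONJECTURE IN PRINT, typed, not asserted). Same proof
as (R1). NOTHING about the printed theorem is asserted here.
[cite: Kobayashi2003, Thm. 7.4 (p. 13), §4 p. 8, Thm. 2.2 (p. 5)] -/
theorem oddBranchStrictMinusDivisibilityOfPlusMCAt_of_kobayashi74OddEta
    (h74 : ∀ (K₀ : Type) [Field K₀] [NumberField K₀] [IsCyclotomicExtension {p} ℚ K₀]
        [(galRange (K := ℚ) K₀).Normal] (η : absoluteGaloisGroup ℚ →* ℤˣ),
        (∀ σ ∈ galRange (K := ℚ) K₀, η σ = 1) → η ≠ 1 →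
      ∀ (V : WeierstrassCurve ℚ) [V.IsElliptic] [V.IsGloballyMinimal] {N : ℕ} [NeZero N]
        {f : CuspForm (Gamma0 N) 2},
        p ≠ 2 → V.HasGoodReductionAtPrime p → V.frobeniusTrace p = 0 →
        QuadraticBranchPlusMainConjectureAt V p → IsNewformOf V f →
      ∀ (ϖ : ℚ), (if Even (p / 2) then (ϖ : ℝ) * V.realPeriodRat = plusPeriod f
          else (ϖ : ℝ) * V.imaginaryPeriodRat = minusPeriod f) →
      ∀ (Lη : IwasawaAlgebra p), IsQuadraticBranchMinusLFunction f p ϖ Lη →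
      ∀ (κ : ZpExtension ℚ p) (γ : absoluteGaloisGroup ℚ),
        κ.IsCyclotomic → κ.IsTopGenerator γ → γ ∈ galRange (K := ℚ) K₀ →
        IsCyclotomicVariable p γ →
      ∀ (D : EtaSignedSelmerDualData V κ K₀ ℚ_[p] η γ (-1)),
        Module.Finite (IwasawaAlgebra p) D.X ∧ Module.IsTorsion (IwasawaAlgebra p) D.X ∧
        ∀ g L' : IwasawaAlgebra p, D.charIdeal = Ideal.span {g} → Lη = PowerSeries.X * L' →
          g ∣ L') :
    OddBranchStrictMinusDivisibilityOfPlusMCAt W p := by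
  intro V _ _ C N _ f hp2 hCV hgood hap hplus hf ϖ hϖ Lη hL κ γ hκ hγ hγc D
  haveI : NeZero p := ⟨(Fact.out : p.Prime).ne_zero⟩
  haveI : IsCyclotomicExtension {p} ℚ (CyclotomicField p ℚ) :=
    CyclotomicField.isCyclotomicExtension p ℚ
  haveI : (galRange (K := ℚ) (CyclotomicField p ℚ)).Normal := normal_galRange_cyclotomic p _
  obtain ⟨θ, η, hθ, hc, hη, hηK, hη1⟩ := exists_theta_eta_cyclotomicField p hp2
  have hD := localTowerHyp_padic p κ (CyclotomicField p ℚ) hκ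
  have hκ₀ := kappa_surjOn_galRange_cyclotomic κ (CyclotomicField p ℚ)
  have hcop := coprime_index_galRange_cyclotomic p (CyclotomicField p ℚ)
  obtain ⟨γ', hγ'K, hγ'κ⟩ := hκ₀ (κ γ)
  have hγγ' : γ⁻¹ * γ' ∈ κ.kerSubgroup := by
    rw [mem_kerSubgroup, map_mul, map_inv, hγ'κ, inv_mul_cancel]
  have hγ' : κ.IsTopGenerator γ' := by rw [ZpExtension.IsTopGenerator, hγ'κ]; exact hγ
  have hγ'c : IsCyclotomicVariable p γ' := isCyclotomicVariable_of_inv_mul_mem_ker hκ hγγ' hγc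
  exact h74 (CyclotomicField p ℚ) η hηK hη1 V hp2 hgood hap hplus hf ϖ hϖ Lη hL κ γ' hκ hγ' hγ'K
    hγ'c (D.toEtaSigned W (CyclotomicField p ℚ) hθ hc p κ hCV η hη ℚ_[p] hD hκ₀ hcop hγ'K hγγ')

end Readings

end Summit.BirchSwinnertonDyer.Rank1Residual.Additive.SignedTwist

end
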